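import Literature.Geometry.Riemannian.ShrinkingSphereEntropy
import Literature.MeasureTheory.Hausdorff.CylinderHausdorffScaling
import Mathlib.MeasureTheory.Group.LIntegral
import HarnessLib

/-!
# The entropy of a round cylinder: `λ(S_V(r) × Vᗮ) = λ(S_V(r))` and Stone's value `Λ_k`

Let `E` be a real inner product space of dimension `n + 1`, `V ≤ E` a subspace of dimension
`k + 1` (`k ≥ 1`) and `Cyl_r = {z | ‖P_V z‖ = r}` (`r > 0`) the round cylinder `S_V(r) × Vᗮ`
(the generalized cylinder `S^k × ℝ^{n-k}`). With the Colding–Minicozzi Gaussian area and entropy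
of `ColdingMinicozziEntropy.lean` (Euclidean Hausdorff measures `μHE[n]` on `E`, `μHE[k]` on `V`):

* `gaussianArea_cylinder_eq` — **`F^{(n)}_{p,t}(Cyl_r) = F^{(k)}_{P_V p, t}(S_V(r))`**: by
  `μHE[n]⌊Cyl_r = μHE[k]⌊S_V(r) ⊗ vol_{Vᗮ}` (`CylinderHausdorffScaling.lean`), Pythagoras
  `‖z - p‖² = ‖P_V z - P_V p‖² + ‖P_{Vᗮ} z - P_{Vᗮ} p‖²` and the Gaussian integral
  `∫_{Vᗮ} e^{-‖b - q‖²/4t} db = (4πt)^{(n-k)/2}`; this is the "simple computation" giving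
  `λ(Σ × ℝ) = λ(Σ)` of Colding–Ilmanen–Minicozzi–White 2013 (Introduction) for `Σ = S^k`;
* `gaussianEntropy_cylinder_eq` — `λ_n(Cyl_r) = λ_k(S_V(r))`;
* `gaussianEntropy_shrinkingCylinder_abstract` — for `r = √(2k)`:
  **`λ(S^k_{√(2k)} × ℝ^{n-k}) = Λ_k`** (`= sphereEntropy k`), by `gaussianEntropy_shrinkingSphere`
  (`ShrinkingSphereEntropy.lean`: Colding–Minicozzi 2012, Lemma 7.10, and Stone's computation).

The coordinate version for `shrinkingCylinder n k ⊆ EuclideanSpace ℝ (Fin (n+1))` and the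
discharge `Stone1994_cylinderEntropy_holds` are in `ColdingMinicozziEntropyValuesProofs.lean`.

## References

* T. H. Colding, T. Ilmanen, W. P. Minicozzi II, B. White, *The round sphere minimizes entropy
  among closed self-shrinkers*, J. Differential Geom. 95 (2013) 53–69, Introduction.
  [ColdingIlmanenMinicozziWhite2013]
* T. H. Colding, W. P. Minicozzi II, *Generic mean curvature flow I; generic singularities*,
  Ann. of Math. 175 (2012), Lemma 7.10. [ColdingMinicozzi2012]
* A. Stone, *A density function and the structure of singularities of the mean curvature flow*,
  Calc. Var. PDE 2 (1994), Appendix A. [Stone1994]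
-/

noncomputable section

open Set Metric Module Submodule Filter Function
open _root_.MeasureTheory _root_.MeasureTheory.Measure
open scoped ENNReal NNReal Topology RealInnerProductSpace Pointwise

namespace Literature.Geometry.Riemannian

variable {E : Type*} [NormedAddCommGroup E] [InnerProductSpace ℝ E] [FiniteDimensional ℝ E]
  [MeasurableSpace E] [BorelSpace E] (V : Submodule ℝ E)

/-- **The Gaussian integral over a subspace, any centre**:
`∫⁻_W e^{-‖b - q‖²/(4t)} db = (4πt)^{dim W / 2}` (translation invariance and
`lintegral_gaussianWeight_zero`). [folklore] -/
theorem lintegral_gaussianWeight_eq (W : Submodule ℝ E) (q : W) {t : ℝ} (ht : 0 < t) :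
    ∫⁻ b, gaussianWeight q t b ∂(volume : Measure W) =
      ENNReal.ofReal ((4 * Real.pi * t) ^ ((Module.finrank ℝ W : ℝ) / 2)) := by
  have h : ∀ b : W, gaussianWeight q t b = gaussianWeight (0 : W) t (b - q) := by
    intro b; simp [gaussianWeight]
  simp_rw [h]
  rw [lintegral_sub_right_eq_self (fun b : W ↦ gaussianWeight (0 : W) t b) q,
    lintegral_gaussianWeight_zero ht]

omit [MeasurableSpace E] [BorelSpace E] in
/-- **The Gaussian weight splits along `V ⊕ Vᗮ`**:
`e^{-‖z - p‖²/4t} = e^{-‖P_V z - P_V p‖²/4t} · e^{-‖P_{Vᗮ} z - P_{Vᗮ} p‖²/4t}` (Pythagoras).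
[folklore] -/
theorem gaussianWeight_eq_mul_orthogonalProjection (p : E) (t : ℝ) (z : E) :
    gaussianWeight p t z =
      gaussianWeight (V.orthogonalProjectionOnto p) t (V.orthogonalProjectionOnto z) *
        gaussianWeight (Vᗮ.orthogonalProjectionOnto p) t (Vᗮ.orthogonalProjectionOnto z) := by
  simp only [gaussianWeight]
  rw [← ENNReal.ofReal_mul (Real.exp_pos _).le, ← Real.exp_add]
  congr 2
  have h := norm_sq_eq_add_norm_sq_projection (z - p) V
  rw [map_sub, map_sub] at h
  rw [h]
  ring

/-- **`F^{(n)}_{p,t}(S_V(r) × Vᗮ) = F^{(k)}_{P_V p, t}(S_V(r))`**: the Gaussian area of the round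
cylinder `{‖P_V z‖ = r}` in `E` (`dim E = n + 1`) equals the Gaussian area of the round sphere
`S_V(r)` in `V` (`dim V = k + 1`, `k ≥ 1`) centred at the projection of the centre, for every
`t > 0`, `r > 0` (Colding–Ilmanen–Minicozzi–White 2013, Introduction: "a simple computation shows
that `λ(Σ × R) = λ(Σ)`"). [cite: ColdingIlmanenMinicozziWhite2013, Introduction] -/
theorem gaussianArea_cylinder_eq {n k : ℕ} (hE : finrank ℝ E = n + 1) (hV : finrank ℝ V = k + 1)
    (hk : 0 < k) {r : ℝ} (hr : 0 < r) (p : E) {t : ℝ} (ht : 0 < t) :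
    gaussianArea n p t {z : E | ‖V.orthogonalProjectionOnto z‖ = r} =
      gaussianArea k (V.orthogonalProjectionOnto p) t (sphere (0 : V) r) := by
  obtain ⟨m, hm⟩ : ∃ m : ℕ, finrank ℝ Vᗮ = m := ⟨_, rfl⟩
  have hnm : k + m = n := by
    have := Submodule.finrank_add_finrank_orthogonal V
    omega
  rw [gaussianArea_eq, gaussianArea_eq]
  simp_rw [gaussianWeight_eq_mul_orthogonalProjection V p t]
  rw [MeasureTheory.Hausdorff.lintegral_cylinder_mul V hE hV hk hr (measurable_gaussianWeight _ _)
    (measurable_gaussianWeight _ _), lintegral_gaussianWeight_eq Vᗮ _ ht, hm, ← mul_assoc,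
    mul_right_comm]
  congr 1
  rw [gaussianNormalization, gaussianNormalization, ← ENNReal.ofReal_mul (Real.rpow_nonneg (by positivity) _),
    ← Real.rpow_add (by positivity)]
  congr 2
  rw [← hnm]
  push_cast
  ring

/-- **`λ_n(S_V(r) × Vᗮ) = λ_k(S_V(r))`**: the entropy of the round cylinder equals the entropy of
its spherical factor (`dim E = n + 1`, `dim V = k + 1`, `k ≥ 1`, `r > 0`).
[cite: ColdingIlmanenMinicozziWhite2013, Introduction] -/
theorem gaussianEntropy_cylinder_eq {n k : ℕ} (hE : finrank ℝ E = n + 1) (hV : finrank ℝ V = k + 1)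
    (hk : 0 < k) {r : ℝ} (hr : 0 < r) :
    gaussianEntropy n {z : E | ‖V.orthogonalProjectionOnto z‖ = r} =
      gaussianEntropy k (sphere (0 : V) r) := by
  rw [gaussianEntropy_eq_iSup, gaussianEntropy_eq_iSup]
  apply le_antisymm
  · refine iSup_le fun p ↦ iSup_le fun t ↦ iSup_le fun ht ↦ ?_
    rw [gaussianArea_cylinder_eq V hE hV hk hr p ht]
    exact le_iSup_of_le (V.orthogonalProjectionOnto p) (le_iSup_of_le t (le_iSup_of_le ht le_rfl))
  · refine iSup_le fun q ↦ iSup_le fun t ↦ iSup_le fun ht ↦ ?_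
    refine le_iSup_of_le (q : E) (le_iSup_of_le t (le_iSup_of_le ht ?_))
    rw [gaussianArea_cylinder_eq V hE hV hk hr (q : E) ht, orthogonalProjectionOnto_mem_subspace_eq_self]

/-- **Stone's value for the generalized self-shrinking cylinder, abstract form**: for a real inner
product space `E` of dimension `n + 1` and a subspace `V` of dimension `k + 1` (`k ≥ 1`), the
round cylinder `S_V(√(2k)) × Vᗮ = {z | ‖P_V z‖ = √(2k)}` has Colding–Minicozzi entropy
`Λ_k = |S^k| (k/(2πe))^{k/2}` (`= sphereEntropy k`): `λ(S^k × ℝ^{n-k}) = λ(S^k) = F_{0,1}(S^k_{√(2k)})`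
(Stone 1994, Appendix A; Colding–Minicozzi 2012, Lemma 7.10; Colding–Ilmanen–Minicozzi–White
2013, Introduction). [cite: ColdingIlmanenMinicozziWhite2013, Introduction] -/
theorem gaussianEntropy_shrinkingCylinder_abstract {n k : ℕ} (hE : finrank ℝ E = n + 1)
    (hV : finrank ℝ V = k + 1) (hk : 0 < k) :
    gaussianEntropy n {z : E | ‖V.orthogonalProjectionOnto z‖ = Real.sqrt (2 * k)} =
      ENNReal.ofReal (sphereEntropy k) := by
  have hr : 0 < Real.sqrt (2 * k) := Real.sqrt_pos.2 (by positivity)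
  rw [gaussianEntropy_cylinder_eq V hE hV hk hr]
  exact gaussianEntropy_shrinkingSphere hV hk

end Literature.Geometry.Riemannian

end
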